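import Literature.AnabelianGeometry.EtaleTheta.BiKummerThm44SubModelPull
import Literature.AnabelianGeometry.EtaleTheta.Discharge.Sec4Thm44OfConnectedTemperoid

/-!
# [EtTh] Theorem 4.4 (i), (ii), (iii) and the `N`-th-roots clause at the GENUINE connected base
# `D := B^temp(Π^tp_X)⁰` — consolidation of the sub-DAG SUBDAG-EtTh-Thm44 at abc-iut-L2-t4's `mkOfConnectedTemperoid`

S. Mochizuki, *The étale theta function …*, Publ. RIMS **45** (2009) [MochizukiEtTh2009], §4, Thm 4.4, p.94
(printed p.320), for the bi-Kummer settings of Def 4.1 over `D_i := B^temp(Π^tp_{X_i})⁰[𝒟_i]` (Def 3.6 (ii): a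
CONNECTED totally epimorphic base).  Cell abc-iut, layer L2, cone nodes `EtTh:Thm4.4(i)/(ii)/(iii)`; seat
abc-iut-w5-d179 (SUBDAG-EtTh-Thm44 custodian).  PROOF-ONLY (no definition, no named fact).

The sub-DAG rows T44-L03 ([FrdI] Thm 3.4), T44-L04 ([FrdI] Cor 5.7), T44-L08/L09/L09c ([SemiAnbd] Prop 3.2 —
abc-iut-w5-d013's `Sec4Thm44OfConnectedTemperoid`, UNCONDITIONAL over the connected parts), T44-L10 with its
pull-back clause ([FrdI] Cor 4.10 / Prop 2.2 (ii) — `psiModel`, `biratCompatible_mkOfModel`,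
`psiModel_pullFracModel`) and T44-L12 ([FrdI] Thm 4.2 (ii)) are theorems; here they are composed ONCE, for
abc-iut-L2-t4's setting `BiKummerSetting.mkOfConnectedTemperoid` over the tree vocabularies
`treeMonoidVocab` / `treeCatVocab` and the CONSTRUCTED `ψ = Ψ^birat` (`Thm44Hyp.psiModel`), `pullFrac := pullFracModel`:
* `Thm44Hyp.thm44_i_mkOfConnectedTemperoid_treeVocab` — Thm 4.4 (i) ⇐ {`Remark372 D₀ / D₀'`, `hBmon₁ / hBmon₂`};
* `Thm44Hyp.thm44_ii_mkOfConnectedTemperoid` — Thm 4.4 (ii), fraction-pair clause ⇐ the same;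
* `Thm44Hyp.thm44_iii_mkOfConnectedTemperoid` — Thm 4.4 (iii), saturation clause ⇐ the same + T44-L15b;
* `Thm44Hyp.preservesNthRoots_mkOfModelCanonical'` — T44-L14 at the canonical model over ARBITRARY bases with the
  "`Φ_i` perf-factorial" inputs of `preservesNthRoots_mkOfModelCanonical` DISCHARGED (at `treeMonoidVocab` they are
  the Def 3.6 (ii) field `TemperedFrobenioid.isPerfFactorial`, [FrdI] Def 2.4 (i));
* `Thm44Hyp.preservesNthRoots_mkOfConnectedTemperoid` — Thm 4.4 (ii), `N`-th-roots clause (T44-L14) ⇐ {`Remark372 D₀ /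
  D₀'`, `hBmon₁ / hBmon₂`, T44-L15b};
* `Thm44Hyp.thm44_mkOfConnectedTemperoid` — the conjunction: **[EtTh] Thm 4.4 (i) ∧ (ii) ∧ (iii)-saturation ∧
  (`N`-th roots) at the genuine connected base ⇐ {Rmk 3.7.2 (`Remark372 D₀ / D₀'`, the tree's named fact for
  [SemiAnbd] Ex 3.10 + [FrdII] Ex 1.3 (i)), `hBmon₁ / hBmon₂` (the rational-function monoid `B` is a monoid on `D`,
  Def 3.6 (ii) datum), T44-L15b ([FrdII] Def 2.2 (ii) over the free `(N,H)`-saturation predicate)} ONLY.**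
The Kummer-class clause of (iii) (T44-L16, abc-iut-L2-t3's `BiKummerThm44SubKummerClass`, review lane) is not
included here.  HONEST FRAMING: refereed pre-IUT material; nothing here asserts that such data exist for an
actual curve or bears on the disputed [IUTchIII] Cor. 3.12; typed ≠ proved — here PROVED (kernel compositions).
-/

noncomputable section

namespace Literature.AnabelianGeometry.EtaleTheta

open CategoryTheory Opposite Literature.AlgebraicGeometry.Frobenioids Literature.AnabelianGeometry.SemiGraphs

namespace BiKummerSetting

universe u₀ v₀ u v w

/-! ### T44-L14 at the canonical model, "`Φ_i` perf-factorial" discharged (tree vocabulary, arbitrary bases) -/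

section Canonical

variable {K : Type u₀} [Field K] {K' : Type u₀} [Field K'] {X₁ : SemiGraphs.TemperedArithmeticGroup.{u₀} K}
  {X₂ : SemiGraphs.TemperedArithmeticGroup.{u₀} K'} {D₀ : Type u₀} [Category.{v₀} D₀] {D₀' : Type u₀}
  [Category.{v₀} D₀'] {T₁ : RealifiedDivisorMonoids (D₀ := D₀) treeMonoidVocab.{w}}
  {T₂ : RealifiedDivisorMonoids (D₀ := D₀') treeMonoidVocab.{w}}
  {D₁ D₂ : Type u} [Category.{v} D₁] [Category.{v} D₂]
  {IsRational₁ IsStrictlyRational₁ : (D₁ᵒᵖ ⥤ CommMonCat.{w}) → Prop}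
  {IsRational₂ IsStrictlyRational₂ : (D₂ᵒᵖ ⥤ CommMonCat.{w}) → Prop}
  {tf₁ : TemperedFrobenioid T₁ D₁ (treeCatVocab D₁ IsRational₁ IsStrictlyRational₁)}
  {hZ₁ : tf₁.monoidType = MonoidType.Z} {hP₁ : ∀ A : D₁ᵒᵖ, IsPerfect (tf₁.Φ.carrier A)}
  {IG₁ : D₁ → Prop} {gS₁ : ∀ A : D₁, IG₁ A → (X₁.Pi →* Aut A)}
  {gSs₁ : ∀ (A : D₁) (hA : IG₁ A), Function.Surjective (gS₁ A hA)}
  {NH₁ : Subgroup (Field.absoluteGaloisGroup K) → tf₁.category → ℕ+ → Prop} {A₀₁ : tf₁.category}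
  {hA₀₁ : PreFrobenioid.IsFrobeniusTrivial tf₁.toElem A₀₁} {hA₀₁' : IG₁ A₀₁.base}
  {tf₂ : TemperedFrobenioid T₂ D₂ (treeCatVocab D₂ IsRational₂ IsStrictlyRational₂)}
  {hZ₂ : tf₂.monoidType = MonoidType.Z} {hP₂ : ∀ A : D₂ᵒᵖ, IsPerfect (tf₂.Φ.carrier A)}
  {IG₂ : D₂ → Prop} {gS₂ : ∀ A : D₂, IG₂ A → (X₂.Pi →* Aut A)}
  {gSs₂ : ∀ (A : D₂) (hA : IG₂ A), Function.Surjective (gS₂ A hA)}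
  {NH₂ : Subgroup (Field.absoluteGaloisGroup K') → tf₂.category → ℕ+ → Prop} {A₀₂ : tf₂.category}
  {hA₀₂ : PreFrobenioid.IsFrobeniusTrivial tf₂.toElem A₀₂} {hA₀₂' : IG₂ A₀₂.base}

/-- **T44-L14 at the canonical model instances over arbitrary bases, "`Φ_i` perf-factorial" DISCHARGED**: at the
monoid vocabulary `treeMonoidVocab` the [FrdI] Def 2.4 (i) inputs `hpf₁ / hpf₂` of `preservesNthRoots_mkOfModelCanonical`
(through abc-iut-L1's `Cor57Hypotheses`) ARE the Def 3.6 (ii) field `TemperedFrobenioid.isPerfFactorial`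
("determines a perf-factorial … monoid on `D`").  Residual: {`Remark372 D₀ / D₀'`, `hBmon₁ / hBmon₂`, T44-L09c, T44-L15b}.
[cite: MochizukiEtTh2009, Thm 4.4 (ii) p.94] -/
theorem Thm44Hyp.preservesNthRoots_mkOfModelCanonical'
    (h : Thm44Hyp (mkOfModelCanonical X₁ tf₁ hZ₁ hP₁ IG₁ gS₁ gSs₁ NH₁ A₀₁ hA₀₁ hA₀₁')
      (mkOfModelCanonical X₂ tf₂ hZ₂ hP₂ IG₂ gS₂ gSs₂ NH₂ A₀₂ hA₀₂ hA₀₂'))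
    (h372 : TemperedFrobenioid.Remark372 D₀) (h372' : TemperedFrobenioid.Remark372 D₀')
    (hBmon₁ : IsMonoidOn tf₁.ratFnFunctor) (hBmon₂ : IsMonoidOn tf₂.ratFnFunctor)
    (h9 : h.GaloisCompatible) (h15 : h.PreservesNHSaturatedBsFld) :
    h.PreservesNthRoots (h.psiModel (tf₁.isFrobenioid_treeCatVocab_of_isMonoidOn hBmon₁)
      (tf₂.isFrobenioid_treeCatVocab_of_isMonoidOn hBmon₂)
      (h.preservesFrobeniusStructure_treeVocab h372 h372' hBmon₁ hBmon₂))
      (fun φ f => tf₁.pullFracModel φ f) (fun φ f => tf₂.pullFracModel φ f) :=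
  h.preservesNthRoots_mkOfModelCanonical h372 h372' hBmon₁ hBmon₂ (fun A => tf₁.isPerfFactorial A)
    (fun B => tf₂.isPerfFactorial B) h9 h15

end Canonical

/-! ### At the genuine connected base `B^temp(Π^tp_X)⁰` -/

section Connected


variable {K : Type u₀} [Field K] {K' : Type u₀} [Field K'] {X₁ : SemiGraphs.TemperedArithmeticGroup.{u₀} K}
  {X₂ : SemiGraphs.TemperedArithmeticGroup.{u₀} K'} {D₀ : Type u₀} [Category.{v₀} D₀] {D₀' : Type u₀}
  [Category.{v₀} D₀'] {T₁ : RealifiedDivisorMonoids (D₀ := D₀) treeMonoidVocab.{w}}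
  {T₂ : RealifiedDivisorMonoids (D₀ := D₀') treeMonoidVocab.{w}}
  {IsRational₁ IsStrictlyRational₁ : ((ConnectedPart (BTemp X₁.Pi))ᵒᵖ ⥤ CommMonCat.{w}) → Prop}
  {IsRational₂ IsStrictlyRational₂ : ((ConnectedPart (BTemp X₂.Pi))ᵒᵖ ⥤ CommMonCat.{w}) → Prop}
  {tf₁ : TemperedFrobenioid T₁ (ConnectedPart (BTemp X₁.Pi))
    (treeCatVocab (ConnectedPart (BTemp X₁.Pi)) IsRational₁ IsStrictlyRational₁)}
  {hZ₁ : tf₁.monoidType = MonoidType.Z} {hP₁ : ∀ A : (ConnectedPart (BTemp X₁.Pi))ᵒᵖ, IsPerfect (tf₁.Φ.carrier A)}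
  {NH₁ : Subgroup (Field.absoluteGaloisGroup K) → tf₁.category → ℕ+ → Prop} {A₁ : tf₁.category}
  {hA₁ : PreFrobenioid.IsFrobeniusTrivial tf₁.toElem A₁} {hA₁' : SemiGraphs.IsGaloisObj A₁.base.obj}
  {tf₂ : TemperedFrobenioid T₂ (ConnectedPart (BTemp X₂.Pi))
    (treeCatVocab (ConnectedPart (BTemp X₂.Pi)) IsRational₂ IsStrictlyRational₂)}
  {hZ₂ : tf₂.monoidType = MonoidType.Z} {hP₂ : ∀ B : (ConnectedPart (BTemp X₂.Pi))ᵒᵖ, IsPerfect (tf₂.Φ.carrier B)}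
  {NH₂ : Subgroup (Field.absoluteGaloisGroup K') → tf₂.category → ℕ+ → Prop} {A₂ : tf₂.category}
  {hA₂ : PreFrobenioid.IsFrobeniusTrivial tf₂.toElem A₂} {hA₂' : SemiGraphs.IsGaloisObj A₂.base.obj}

/-- **Thm 4.4 (i) at the genuine connected base, tree vocabulary**: `Ψ` maps isomorphs of `A_{⊙,1}` to isomorphs of
`A_{⊙,2}`, `H_{⊙,1}`-ample objects to `H_{⊙,2}`-ample objects, and `Ψ^bs` induces `H_{⊙,1} ⥲ H_{⊙,2}` — abc-iut-w5-d013's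
`thm44_i_mkOfConnectedTemperoid` with its two inputs "`C₂` is a Frobenioid" ([FrdI] Thm 5.2 (ii),
`isFrobenioid_treeCatVocab_of_isMonoidOn`) and T44-L03 (`preservesFrobeniusStructure_treeVocab`) supplied from
{Rmk 3.7.2, `hBmon`}. [cite: MochizukiEtTh2009, Thm 4.4 (i) p.94] -/
theorem Thm44Hyp.thm44_i_mkOfConnectedTemperoid_treeVocab
    (h : Thm44Hyp (mkOfConnectedTemperoid X₁ tf₁ hZ₁ hP₁ NH₁ A₁ hA₁ hA₁')
      (mkOfConnectedTemperoid X₂ tf₂ hZ₂ hP₂ NH₂ A₂ hA₂ hA₂'))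
    (h372 : TemperedFrobenioid.Remark372 D₀) (h372' : TemperedFrobenioid.Remark372 D₀')
    (hBmon₁ : IsMonoidOn tf₁.ratFnFunctor) (hBmon₂ : IsMonoidOn tf₂.ratFnFunctor) : Thm44_i h :=
  h.thm44_i_mkOfConnectedTemperoid _ _ _ _ _ _ _ _ _ _ _ _ _ _ (tf₂.isFrobenioid_treeCatVocab_of_isMonoidOn hBmon₂)
    (h.preservesFrobeniusStructure_treeVocab h372 h372' hBmon₁ hBmon₂)

/-- **Thm 4.4 (ii), fraction-pair clause, at the genuine connected base** for the CONSTRUCTED `ψ = Ψ^birat`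
(`psiModel`) ⇐ {Rmk 3.7.2, `hBmon`} — the canonical-model theorem `thm44_ii_mkOfModelCanonical` (T44-L03, L10, L12
discharged) read at `mkOfConnectedTemperoid`. [cite: MochizukiEtTh2009, Thm 4.4 (ii) p.94] -/
theorem Thm44Hyp.thm44_ii_mkOfConnectedTemperoid
    (h : Thm44Hyp (mkOfConnectedTemperoid X₁ tf₁ hZ₁ hP₁ NH₁ A₁ hA₁ hA₁')
      (mkOfConnectedTemperoid X₂ tf₂ hZ₂ hP₂ NH₂ A₂ hA₂ hA₂'))
    (h372 : TemperedFrobenioid.Remark372 D₀) (h372' : TemperedFrobenioid.Remark372 D₀')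
    (hBmon₁ : IsMonoidOn tf₁.ratFnFunctor) (hBmon₂ : IsMonoidOn tf₂.ratFnFunctor) :
    Thm44_ii h (h.psiModel (tf₁.isFrobenioid_treeCatVocab_of_isMonoidOn hBmon₁)
      (tf₂.isFrobenioid_treeCatVocab_of_isMonoidOn hBmon₂)
      (h.preservesFrobeniusStructure_treeVocab h372 h372' hBmon₁ hBmon₂)) :=
  thm44_ii_mkOfModelCanonical h h372 h372' hBmon₁ hBmon₂

/-- **Thm 4.4 (iii), saturation clause (v5), at the genuine connected base** for `ψ = psiModel` ⇐ {Rmk 3.7.2,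
`hBmon`, T44-L15b} (`thm44_iii_of_remark372`: T44-L03 and its `Ψ⁻¹`-twin from [FrdI] Thm 3.4 (iii)).
[cite: MochizukiEtTh2009, Thm 4.4 (iii) p.94] -/
theorem Thm44Hyp.thm44_iii_mkOfConnectedTemperoid
    (h : Thm44Hyp (mkOfConnectedTemperoid X₁ tf₁ hZ₁ hP₁ NH₁ A₁ hA₁ hA₁')
      (mkOfConnectedTemperoid X₂ tf₂ hZ₂ hP₂ NH₂ A₂ hA₂ hA₂'))
    (h372 : TemperedFrobenioid.Remark372 D₀) (h372' : TemperedFrobenioid.Remark372 D₀')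
    (hBmon₁ : IsMonoidOn tf₁.ratFnFunctor) (hBmon₂ : IsMonoidOn tf₂.ratFnFunctor)
    (h15 : h.PreservesNHSaturatedBsFld) :
    Thm44_iii h (h.psiModel (tf₁.isFrobenioid_treeCatVocab_of_isMonoidOn hBmon₁)
      (tf₂.isFrobenioid_treeCatVocab_of_isMonoidOn hBmon₂)
      (h.preservesFrobeniusStructure_treeVocab h372 h372' hBmon₁ hBmon₂)) :=
  h.thm44_iii_of_remark372 _ (tf₁.isFrobenioid_treeCatVocab_of_isMonoidOn hBmon₁)
    (tf₂.isFrobenioid_treeCatVocab_of_isMonoidOn hBmon₂) h372 h372' h.isNonDilatingOn_ofFunctor₁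
    h.isNonDilatingOn_ofFunctor₂ h15

/-- **Thm 4.4 (ii), `N`-th-roots clause (T44-L14), at the genuine connected base**: `Ψ` maps `N`-th roots of
fraction-pairs to `N`-th roots of fraction-pairs, for `ψ = psiModel` and the model pull-backs `pullFracModel`
⇐ {Rmk 3.7.2, `hBmon`, T44-L15b} — `preservesNthRoots_mkOfModelCanonical'` with its input T44-L09c DISCHARGED by
abc-iut-w5-d013's `galoisCompatible_mkOfConnectedTemperoid` ([SemiAnbd] Prop 3.2 over `B^temp(Π^tp_X)⁰`). [cite: MochizukiEtTh2009, Thm 4.4 (ii) p.94] -/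
theorem Thm44Hyp.preservesNthRoots_mkOfConnectedTemperoid
    (h : Thm44Hyp (mkOfConnectedTemperoid X₁ tf₁ hZ₁ hP₁ NH₁ A₁ hA₁ hA₁')
      (mkOfConnectedTemperoid X₂ tf₂ hZ₂ hP₂ NH₂ A₂ hA₂ hA₂'))
    (h372 : TemperedFrobenioid.Remark372 D₀) (h372' : TemperedFrobenioid.Remark372 D₀')
    (hBmon₁ : IsMonoidOn tf₁.ratFnFunctor) (hBmon₂ : IsMonoidOn tf₂.ratFnFunctor)
    (h15 : h.PreservesNHSaturatedBsFld) :
    h.PreservesNthRoots (h.psiModel (tf₁.isFrobenioid_treeCatVocab_of_isMonoidOn hBmon₁)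
      (tf₂.isFrobenioid_treeCatVocab_of_isMonoidOn hBmon₂)
      (h.preservesFrobeniusStructure_treeVocab h372 h372' hBmon₁ hBmon₂))
      (fun φ f => tf₁.pullFracModel φ f) (fun φ f => tf₂.pullFracModel φ f) :=
  h.preservesNthRoots_mkOfModelCanonical' h372 h372' hBmon₁ hBmon₂
    (h.galoisCompatible_mkOfConnectedTemperoid _ _ _ _ _ _ _ _ _ _ _ _ _ _) h15

/-- **[EtTh] Theorem 4.4 at the genuine connected base `B^temp(Π^tp_X)⁰`, consolidated**: (i) ∧ (ii) (fraction-pairs)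
∧ (iii) (saturation) ∧ (ii) (`N`-th roots), for the settings `mkOfConnectedTemperoid` over the tree vocabularies,
the CONSTRUCTED `ψ = Ψ^birat` and the model pull-backs — modulo ONLY {Rmk 3.7.2 (`Remark372 D₀ / D₀'`, named fact),
`hBmon₁ / hBmon₂` (Def 3.6 (ii) datum: `B` a monoid on `D`), T44-L15b ([FrdII] Def 2.2 (ii))}; every other printed input of the proof on p.95 ([FrdI] Thm 3.4, Cor 4.10 + Prop 2.2 (ii), Thm 4.2 (ii),
Cor 5.7; [SemiAnbd] Prop 3.2; Thm 3.7 (i)) is a theorem of the tree. [cite: MochizukiEtTh2009, Thm 4.4 p.94] -/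
theorem Thm44Hyp.thm44_mkOfConnectedTemperoid
    (h : Thm44Hyp (mkOfConnectedTemperoid X₁ tf₁ hZ₁ hP₁ NH₁ A₁ hA₁ hA₁')
      (mkOfConnectedTemperoid X₂ tf₂ hZ₂ hP₂ NH₂ A₂ hA₂ hA₂'))
    (h372 : TemperedFrobenioid.Remark372 D₀) (h372' : TemperedFrobenioid.Remark372 D₀')
    (hBmon₁ : IsMonoidOn tf₁.ratFnFunctor) (hBmon₂ : IsMonoidOn tf₂.ratFnFunctor)
    (h15 : h.PreservesNHSaturatedBsFld) :
    Thm44_i h ∧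
      Thm44_ii h (h.psiModel (tf₁.isFrobenioid_treeCatVocab_of_isMonoidOn hBmon₁)
        (tf₂.isFrobenioid_treeCatVocab_of_isMonoidOn hBmon₂)
        (h.preservesFrobeniusStructure_treeVocab h372 h372' hBmon₁ hBmon₂)) ∧
      Thm44_iii h (h.psiModel (tf₁.isFrobenioid_treeCatVocab_of_isMonoidOn hBmon₁)
        (tf₂.isFrobenioid_treeCatVocab_of_isMonoidOn hBmon₂)
        (h.preservesFrobeniusStructure_treeVocab h372 h372' hBmon₁ hBmon₂)) ∧
      h.PreservesNthRoots (h.psiModel (tf₁.isFrobenioid_treeCatVocab_of_isMonoidOn hBmon₁)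
        (tf₂.isFrobenioid_treeCatVocab_of_isMonoidOn hBmon₂)
        (h.preservesFrobeniusStructure_treeVocab h372 h372' hBmon₁ hBmon₂))
        (fun φ f => tf₁.pullFracModel φ f) (fun φ f => tf₂.pullFracModel φ f) :=
  ⟨h.thm44_i_mkOfConnectedTemperoid_treeVocab h372 h372' hBmon₁ hBmon₂,
    h.thm44_ii_mkOfConnectedTemperoid h372 h372' hBmon₁ hBmon₂,
    h.thm44_iii_mkOfConnectedTemperoid h372 h372' hBmon₁ hBmon₂ h15,
    h.preservesNthRoots_mkOfConnectedTemperoid h372 h372' hBmon₁ hBmon₂ h15⟩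

end Connected

end BiKummerSetting

end Literature.AnabelianGeometry.EtaleTheta

end
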